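import Summits.MatrixMultiplication.MatrixMultiplication.Theorems.ObstructionDescentUniversalOccurrenceTwoRectangleFourOddValue

set_option linter.dupNamespace false
set_option autoImplicit false

/-!
# Universal occurrence — two rectangles and ALL the hook-domino types: `((2^N),(2^N),(2N-2j-3,2j+1,1,1)) ∈ S(⟨m⟩)`, `m ≥ N+2`
(decomp-mm · lens 3 · gen 44, K32-F)

Route `route-MatrixMultiplication-ObstructionDescent` (sub-problem `MatrixMultiplication`, `ω(ℂ) = 2`); SUPPORT for the crux
`NoOccurrenceObstruction` (`P_O`, item `stmt-MatrixMultiplication-29040`), universal-occurrence programme (NODE-g29…g44 of the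
decomp-mm cell, lens 3).  Nothing here proves `ω = 2` or closes an item; no `def`, no `sorry`, standard axioms.
`occurs_unitTensor_twoRectangle_fourOdd`: for all `j`, all `N ≥ max(4, 2j+2)` and all `m ≥ N + 2` the type
`((2^N),(2^N),(2N-2j-3,2j+1,1,1))` occurs for `⟨m⟩` — i.e. EVERY type `((2^N),(2^N),(a,b,1,1))` with `a ≥ b` odd of the
two-rectangular sector (the whole sub-class `ν = (a,b,1,1)` of the FOUR-ODD class; `j = 0, 1, 2` are the landed families
`…TwoRectangleOddHook/OddThree/OddFive`).  Four odd parts are invisible to floor designs and, by weights, to `⟨N+1⟩` (memo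
NODE-g44 §3, census I245), so the threshold `N + 2` is exact.  Certificate: the STOREY LAW (`…TwoRectangleStorey`) on the LIFTED
DESIGN `D'_j(N)` over `[N+2]` — legs `φ = (0,…,N-1 | 0,1)`, `ψ = (0,…,N-1 | 1,0)`, `γ(n) = 1 (1 ≤ n ≤ j+1), γ(N) = 2,
γ(N+1) = 3` read into `e_T` of the `(2N-2j-3,2j+1,1,1)` tableau (`…FourOddTableaux`: column `0..3`, `2j` dominoes, arm),
blocks `e = (q mod 2, q div 2)`, `e' = e ∘ (p₀ p₁)`.  Every non-zero term is `(-1)^{j+1}` (`…FourOddValue`), so the pairing is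
`(-1)^{j+1}` times the number of supported terms; witness `ι_w`: column `(N, N+1, 1, 0)`, domino tops `q ↦ q/2`, domino
bottoms `q ↦ q/2 + j` (first `j`), `q/2 - j` (last `j`), arm `q ↦ q/2`.
[cite: BurgisserIkenmeyer2011, §3.4 (Prop. 3.4), Thm. 4.4, Lemma 6.1] [cite: BurgisserIkenmeyer2017, §5, Thm. 5.9 (proof of (2)),
eq. (3.4)] [cite: Landsberg2017, §9.1.1]
-/

noncomputable section

open scoped BigOperators

namespace Summit.MatrixMultiplication.MatrixMultiplication.Theorems.ObstructionCalculus

open Literature.Computability.AlgebraicComplexity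
open Literature.NumberTheory.DiophantineGeometry

/-! ## Arithmetic of the witness `ι_w` (pure `ℕ`, one `split_ifs`/`omega` lemma each) -/

set_option maxHeartbeats 400000 in
/-- First leg of the witness `φ ∘ ι_w`. [this node] -/
theorem fourOddWitness_fst {N j q v : ℕ} (hN : 2 * j + 2 ≤ N) (hq : q < N * 2)
    (hv : v = (if q = 0 then N else if q = 1 then N + 1 else if q = 3 then 0 else if q % 2 = 0 then q / 2 else if q < 2 * j + 5 then q / 2 + j else if q < 4 * j + 5 then q / 2 - j else q / 2)) :
    (if v < N then v else v - N) =
      (if q = 0 then 0 else if q = 1 then 1 else if q = 3 then 0 else if q % 2 = 0 then q / 2 else if q < 2 * j + 5 then q / 2 + j else if q < 4 * j + 5 then q / 2 - j else q / 2) := by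
  split_ifs at hv ⊢ <;> omega

set_option maxHeartbeats 400000 in
/-- Second leg of the witness off the cells `0, 1`: `ψ ∘ ι_w = φ ∘ ι_w` there. [this node] -/
theorem fourOddWitness_snd {N j q v : ℕ} (hN : 2 * j + 2 ≤ N) (hq : q < N * 2) (hq0 : q ≠ 0) (hq1 : q ≠ 1)
    (hv : v = (if q = 0 then N else if q = 1 then N + 1 else if q = 3 then 0 else if q % 2 = 0 then q / 2 else if q < 2 * j + 5 then q / 2 + j else if q < 4 * j + 5 then q / 2 - j else q / 2)) :
    (if v < N then v else N + 1 - v) =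
      (if q = 0 then 0 else if q = 1 then 1 else if q = 3 then 0 else if q % 2 = 0 then q / 2 else if q < 2 * j + 5 then q / 2 + j else if q < 4 * j + 5 then q / 2 - j else q / 2) := by
  split_ifs at hv ⊢ <;> omega

/-- Block `0` of the first leg of the witness (slots `s ↦ 2s`): the identity. [this node] -/
theorem fourOddWitness_block0 {j s : ℕ} :
    (if (0 + 2 * s) = 0 then 0 else if (0 + 2 * s) = 1 then 1 else if (0 + 2 * s) = 3 then 0 else if (0 + 2 * s) % 2 = 0 then (0 + 2 * s) / 2 else if (0 + 2 * s) < 2 * j + 5 then (0 + 2 * s) / 2 + j else if (0 + 2 * s) < 4 * j + 5 then (0 + 2 * s) / 2 - j else (0 + 2 * s) / 2) = s := by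
  split_ifs <;> omega

/-- Block `1` of the first leg of the witness (slots `s ↦ 2s+1`): `(0 1)` and the swap of the slot intervals `[2, j+1]`,
`[j+2, 2j+1]`. [this node] -/
theorem fourOddWitness_block1 {j s : ℕ} :
    (if (1 + 2 * s) = 0 then 0 else if (1 + 2 * s) = 1 then 1 else if (1 + 2 * s) = 3 then 0 else if (1 + 2 * s) % 2 = 0 then (1 + 2 * s) / 2 else if (1 + 2 * s) < 2 * j + 5 then (1 + 2 * s) / 2 + j else if (1 + 2 * s) < 4 * j + 5 then (1 + 2 * s) / 2 - j else (1 + 2 * s) / 2) =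
      (if s = 0 then 1 else if s = 1 then 0 else if s < j + 2 then s + j else if s < 2 * j + 2 then s - j else s) := by
  split_ifs <;> omega

set_option maxHeartbeats 400000 in
/-- Block `1` of the first leg of the witness is injective. [this node] -/
theorem fourOddWitness_block1_inj {j s s' : ℕ}
    (h : (if s = 0 then 1 else if s = 1 then 0 else if s < j + 2 then s + j else if s < 2 * j + 2 then s - j else s) =
      (if s' = 0 then 1 else if s' = 1 then 0 else if s' < j + 2 then s' + j else if s' < 2 * j + 2 then s' - j else s')) : s = s' := by
  split_ifs at h <;> omega

set_option maxHeartbeats 400000 in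
/-- Third leg of the witness `γ ∘ ι_w`: column `(2, 3, 1, 0)`, dominoes `(1,0)` (first `j`) and `(0,1)` (last `j`), zero arm.
[this node] -/
theorem fourOddWitness_third {N j q v : ℕ} (hN : 2 * j + 2 ≤ N) (hq : q < N * 2)
    (hv : v = (if q = 0 then N else if q = 1 then N + 1 else if q = 3 then 0 else if q % 2 = 0 then q / 2 else if q < 2 * j + 5 then q / 2 + j else if q < 4 * j + 5 then q / 2 - j else q / 2)) :
    (if v = 0 then 0 else if v < j + 2 then 1 else if v = N then 2 else if v = N + 1 then 3 else 0) =
      (if q = 0 then 2 else if q = 1 then 3 else if q = 2 then 1 else if q = 3 then 0 else if q < 2 * j + 4 then (q + 1) % 2 else if q < 4 * j + 4 then q % 2 else 0) := by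
  split_ifs at hv ⊢ <;> omega

set_option maxHeartbeats 400000 in
/-- The column reading `(2, 3, 1, 0)` of the third leg of the witness is injective. [this node] -/
theorem fourOddWitness_third_inj {j q q' : ℕ} (hq : q < 4) (hq' : q' < 4)
    (h : (if q = 0 then 2 else if q = 1 then 3 else if q = 2 then 1 else if q = 3 then 0 else if q < 2 * j + 4 then (q + 1) % 2 else if q < 4 * j + 4 then q % 2 else 0) =
      (if q' = 0 then 2 else if q' = 1 then 3 else if q' = 2 then 1 else if q' = 3 then 0 else if q' < 2 * j + 4 then (q' + 1) % 2 else if q' < 4 * j + 4 then q' % 2 else 0)) : q = q' := by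
  split_ifs at h <;> omega

set_option maxHeartbeats 400000 in
/-- The dominoes of the third leg of the witness read `(1,0)` (first `j`) and `(0,1)` (last `j`). [this node] -/
theorem fourOddWitness_dominoes {j p q : ℕ} (hp : 4 ≤ p) (hq : q < 4 * j + 4) (hqp : q = p + 1) (hpe : p % 2 = 0) :
    (if p = 0 then 2 else if p = 1 then 3 else if p = 2 then 1 else if p = 3 then 0 else if p < 2 * j + 4 then (p + 1) % 2 else if p < 4 * j + 4 then p % 2 else 0) +
      (if q = 0 then 2 else if q = 1 then 3 else if q = 2 then 1 else if q = 3 then 0 else if q < 2 * j + 4 then (q + 1) % 2 else if q < 4 * j + 4 then q % 2 else 0) = 1 := by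
  split_ifs <;> omega

set_option maxHeartbeats 800000 in
/-- **`((2^N),(2^N),(2N-2j-3,2j+1,1,1))` occurs for `⟨m⟩` for all `j`, `N ≥ max(4, 2j+2)`, `m ≥ N + 2`** — every type
`((2^N),(2^N),(a,b,1,1))`, `a ≥ b` odd.  Certificate: the storey law on the lifted design `D'_j(N)` (every term `0` or
`(-1)^{j+1}`). [cite: BurgisserIkenmeyer2011, Thm. 4.4, Lemma 6.1] [cite: BurgisserIkenmeyer2017, Thm. 5.9 (proof of (2)), eq. (3.4)] -/
theorem occurs_unitTensor_twoRectangle_fourOdd {N m j : ℕ} (h4 : 4 ≤ N) (hN : 2 * j + 2 ≤ N) (hNm : N + 2 ≤ m)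
    {lam : Fin 3 → Nat.Partition (N * 2)} (h0 : lam 0 = Nat.Partition.rectangle N 2)
    (h1 : lam 1 = Nat.Partition.rectangle N 2) (h2 : (lam 2).sortedParts = [2 * N - (2 * j + 3), 2 * j + 1, 1, 1]) :
    isotypicSum₁ (lam 0) (isotypicSum₂ (lam 1) (isotypicSum₃ (lam 2)
      (kroneckerPow (unitTensor ℂ m) (N * 2)))) ≠ 0 := by
  classical
  -- the shape and the tableau `T`
  have hNY : ∀ x ∈ (lam 2).youngDiagram.cells, x.1 < N := fun x hx => by
    have := fst_lt_of_mem_youngDiagram_fourOdd (lam 2) h2 hx; omega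
  have hd : (lam 2).youngDiagram.cells.card = N * 2 := Nat.Partition.card_cells_youngDiagram _
  have hj4 : 4 * j + 4 ≤ N * 2 := by omega
  obtain ⟨T, hT⟩ : ∃ T : StdFilling (N * 2) (lam 2).youngDiagram, ∀ p : Fin (N * 2), T.1 p =
      (if (p : ℕ) < 4 then ((p : ℕ), 0) else if (p : ℕ) < 4 * j + 4 then ((p : ℕ) % 2, (p : ℕ) / 2 - 1)
        else (0, (p : ℕ) - (2 * j + 3))) :=
    ⟨⟨fun p => if (p : ℕ) < 4 then ((p : ℕ), 0) else if (p : ℕ) < 4 * j + 4 then ((p : ℕ) % 2, (p : ℕ) / 2 - 1)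
        else (0, (p : ℕ) - (2 * j + 3)),
      ⟨fun p => fourOddCell_mem hN (lam 2) h2 p p.2,
       fun p q hpq => Fin.ext (fourOddCell_injective hpq),
       fun p q hpq => fourOddCell_standard hpq⟩⟩, fun p => rfl⟩
  have hM : StdFilling.polytabloid ℂ hNY T ∈
      highestWeightSpace (wordRep ℂ N (N * 2)) (Weight.ofPartition N (lam 2)) := by
    rw [← ydWeight_youngDiagram]; exact StdFilling.polytabloid_mem hNY T hd
  -- the cells `p₀, p₁`, the block structures `e`, `e' = e ∘ (p₀ p₁)`
  obtain ⟨p0, hp0⟩ : ∃ p : Fin (N * 2), (p : ℕ) = 0 := ⟨⟨0, by omega⟩, rfl⟩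
  obtain ⟨p1, hp1⟩ : ∃ p : Fin (N * 2), (p : ℕ) = 1 := ⟨⟨1, by omega⟩, rfl⟩
  have hpne : ∀ {q q' : Fin (N * 2)}, (q : ℕ) ≠ (q' : ℕ) → q ≠ q' := fun h hqq' => h (congrArg Fin.val hqq')
  obtain ⟨e, he⟩ : ∃ e : Fin (N * 2) ≃ Fin 2 × Fin N,
      e = finProdFinEquiv.symm.trans (Equiv.prodComm (Fin N) (Fin 2)) := ⟨_, rfl⟩
  have hev : ∀ q : Fin (N * 2), (((e q).1 : Fin 2) : ℕ) = (q : ℕ) % 2 ∧ (((e q).2 : Fin N) : ℕ) = (q : ℕ) / 2 := by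
    intro q; rw [he]; simp [Fin.modNat, Fin.divNat]
  have hesymm : ∀ (a : Fin 2) (s : Fin N), ((e.symm (a, s) : Fin (N * 2)) : ℕ) = (a : ℕ) + 2 * (s : ℕ) := by
    intro a s
    obtain ⟨ha, hs⟩ := hev (e.symm (a, s))
    rw [Equiv.apply_symm_apply] at ha hs
    dsimp only at ha hs
    omega
  obtain ⟨κ, hκ⟩ : ∃ κ : Equiv.Perm (Fin (N * 2)), κ = Equiv.swap p0 p1 := ⟨_, rfl⟩
  have hκv : ∀ q : Fin (N * 2), ((κ q : Fin (N * 2)) : ℕ) =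
      if (q : ℕ) = 0 then 1 else if (q : ℕ) = 1 then 0 else (q : ℕ) := by
    intro q
    rw [hκ]
    by_cases hq0 : (q : ℕ) = 0
    · rw [show q = p0 from Fin.ext (by rw [hq0, hp0]), Equiv.swap_apply_left, hp0, hp1]; simp
    · by_cases hq1 : (q : ℕ) = 1
      · rw [show q = p1 from Fin.ext (by rw [hq1, hp1]), Equiv.swap_apply_right, hp0, hp1]; simp
      · rw [Equiv.swap_apply_of_ne_of_ne (hpne (by omega)) (hpne (by omega)), if_neg hq0, if_neg hq1]
  have hκ0 : κ p0 = p1 := by rw [hκ, Equiv.swap_apply_left]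
  have hκ1 : κ p1 = p0 := by rw [hκ, Equiv.swap_apply_right]
  have hκq : ∀ q : Fin (N * 2), (q : ℕ) ≠ 0 → (q : ℕ) ≠ 1 → κ q = q := fun q hq0 hq1 => by
    rw [hκ]; exact Equiv.swap_apply_of_ne_of_ne (hpne (by omega)) (hpne (by omega))
  obtain ⟨e', he'⟩ : ∃ e' : Fin (N * 2) ≃ Fin 2 × Fin N, e' = κ.symm.trans e := ⟨_, rfl⟩
  have hζ' : ∀ y : Word N (N * 2), wordBlockSign ℂ e' y = wordBlockSign ℂ e (y ∘ ⇑κ) := by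
    intro y; rw [he', wordBlockSign_comp_perm]
  -- the design `D'_j(N)` on the alphabet `[N+2]`
  obtain ⟨φ, hφv⟩ : ∃ φ : Fin (N + 2) → Fin N, ∀ r, ((φ r : Fin N) : ℕ) =
      if (r : ℕ) < N then (r : ℕ) else (r : ℕ) - N :=
    ⟨fun r => ⟨if (r : ℕ) < N then (r : ℕ) else (r : ℕ) - N, by have := r.2; split_ifs <;> omega⟩, fun r => rfl⟩
  obtain ⟨ψ, hψv⟩ : ∃ ψ : Fin (N + 2) → Fin N, ∀ r, ((ψ r : Fin N) : ℕ) =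
      if (r : ℕ) < N then (r : ℕ) else N + 1 - (r : ℕ) :=
    ⟨fun r => ⟨if (r : ℕ) < N then (r : ℕ) else N + 1 - (r : ℕ), by have := r.2; split_ifs <;> omega⟩, fun r => rfl⟩
  obtain ⟨γ, hγv⟩ : ∃ γ : Fin (N + 2) → Fin N, ∀ r, ((γ r : Fin N) : ℕ) =
      if (r : ℕ) = 0 then 0 else if (r : ℕ) < j + 2 then 1 else if (r : ℕ) = N then 2 else if (r : ℕ) = N + 1 then 3 else 0 :=
    ⟨fun r => ⟨if (r : ℕ) = 0 then 0 else if (r : ℕ) < j + 2 then 1 else if (r : ℕ) = N then 2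
        else if (r : ℕ) = N + 1 then 3 else 0, by split_ifs <;> omega⟩, fun r => rfl⟩
  refine occurs_unitTensor_twoRectangle_of_liftDesign_ne_zero (le_trans (Nat.le_add_right N 2) hNm) hNm φ ψ γ e e'
    h0 h1 hM ?_
  -- every non-zero term equals `ε = (-1)^(j+1)` (`…FourOddValue`), so the sum is `ε` times the number of supported terms
  have hε0 : (if j % 2 = 0 then (-1 : ℂ) else 1) ≠ 0 := by split_ifs <;> norm_num
  have hterm : ∀ ι : Fin (N * 2) → Fin (N + 2),
      wordBlockSign ℂ e (φ ∘ ι) * (wordBlockSign ℂ e' (ψ ∘ ι) * StdFilling.polytabloid ℂ hNY T (γ ∘ ι)) =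
        (if j % 2 = 0 then (-1 : ℂ) else 1) *
          (if wordBlockSign ℂ e (φ ∘ ι) * (wordBlockSign ℂ e' (ψ ∘ ι) * StdFilling.polytabloid ℂ hNY T (γ ∘ ι)) ≠ 0
            then 1 else 0) := by
    intro ι
    by_cases h : wordBlockSign ℂ e (φ ∘ ι) * (wordBlockSign ℂ e' (ψ ∘ ι) * StdFilling.polytabloid ℂ hNY T (γ ∘ ι)) = 0
    · rw [h, if_neg (not_not.2 rfl), mul_zero]
    · rw [if_pos h, mul_one]
      rw [hζ'] at h ⊢
      exact fourOdd_liftTerm_eq hN hNY T hT e hev κ hκv φ ψ γ hφv hψv hγv ι h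
  intro hsum
  rw [Finset.sum_congr rfl (fun ι _ => hterm ι), ← Finset.mul_sum, mul_eq_zero] at hsum
  have hsum' := hsum.resolve_left hε0
  rw [Finset.sum_boole, Nat.cast_eq_zero, Finset.card_eq_zero, Finset.filter_eq_empty_iff] at hsum'
  -- the witness `ι_w`
  obtain ⟨ιw, hιw⟩ : ∃ ι : Fin (N * 2) → Fin (N + 2), ∀ q, ((ι q : Fin (N + 2)) : ℕ) =
      (if (q : ℕ) = 0 then N else if (q : ℕ) = 1 then N + 1 else if (q : ℕ) = 3 then 0 else if (q : ℕ) % 2 = 0 then (q : ℕ) / 2 else if (q : ℕ) < 2 * j + 5 then (q : ℕ) / 2 + j else if (q : ℕ) < 4 * j + 5 then (q : ℕ) / 2 - j else (q : ℕ) / 2) :=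
    ⟨fun q => ⟨(if (q : ℕ) = 0 then N else if (q : ℕ) = 1 then N + 1 else if (q : ℕ) = 3 then 0 else if (q : ℕ) % 2 = 0 then (q : ℕ) / 2 else if (q : ℕ) < 2 * j + 5 then (q : ℕ) / 2 + j else if (q : ℕ) < 4 * j + 5 then (q : ℕ) / 2 - j else (q : ℕ) / 2),
        by have := q.2; split_ifs <;> omega⟩, fun q => rfl⟩
  apply hsum' (Finset.mem_univ ιw)
  rw [hζ']
  -- the first-leg word and the agreement of the first two legs: `ψ ∘ ι_w ∘ κ = φ ∘ ι_w`
  have hxwv : ∀ q : Fin (N * 2), (((φ ∘ ιw) q : Fin N) : ℕ) =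
      (if (q : ℕ) = 0 then 0 else if (q : ℕ) = 1 then 1 else if (q : ℕ) = 3 then 0 else if (q : ℕ) % 2 = 0 then (q : ℕ) / 2 else if (q : ℕ) < 2 * j + 5 then (q : ℕ) / 2 + j else if (q : ℕ) < 4 * j + 5 then (q : ℕ) / 2 - j else (q : ℕ) / 2) := by
    intro q
    show ((φ (ιw q) : Fin N) : ℕ) = _
    rw [hφv]
    exact fourOddWitness_fst hN q.2 (hιw q)
  have hιw0 : ((ιw p0 : Fin (N + 2)) : ℕ) = N := by rw [hιw, hp0]; simp
  have hιw1 : ((ιw p1 : Fin (N + 2)) : ℕ) = N + 1 := by rw [hιw, hp1]; simp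
  have hχw : (ψ ∘ ιw) ∘ ⇑κ = φ ∘ ιw := by
    funext q
    apply Fin.ext
    show ((ψ (ιw (κ q)) : Fin N) : ℕ) = (((φ ∘ ιw) q : Fin N) : ℕ)
    rw [hxwv, hψv]
    by_cases hq0 : (q : ℕ) = 0
    · rw [show q = p0 from Fin.ext (by rw [hq0, hp0]), hκ0, hιw1, hp0, if_neg (by omega)]; simp
    · by_cases hq1 : (q : ℕ) = 1
      · rw [show q = p1 from Fin.ext (by rw [hq1, hp1]), hκ1, hιw0, hp1, if_neg (by omega)]; simp
      · rw [hκq q hq0 hq1]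
        exact fourOddWitness_snd hN q.2 hq0 hq1 (hιw q)
  -- `φ ∘ ι_w` is a block bijection (block `0`: the identity; block `1`: `(0 1)` and an interval swap)
  have hblkw0 : ∀ s : Fin N, (((φ ∘ ιw) (e.symm (0, s)) : Fin N) : ℕ) = (s : ℕ) := by
    intro s
    rw [hxwv, hesymm, Fin.val_zero]
    exact fourOddWitness_block0
  have hblkw1 : ∀ s : Fin N, (((φ ∘ ιw) (e.symm (1, s)) : Fin N) : ℕ) =
      (if (s : ℕ) = 0 then 1 else if (s : ℕ) = 1 then 0 else if (s : ℕ) < j + 2 then (s : ℕ) + j else if (s : ℕ) < 2 * j + 2 then (s : ℕ) - j else (s : ℕ)) := by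
    intro s
    rw [hxwv, hesymm, Fin.val_one]
    exact fourOddWitness_block1
  have hbijw : ∀ a : Fin 2, Function.Bijective (fun s => (φ ∘ ιw) (e.symm (a, s))) := by
    intro a
    have ha : a = 0 ∨ a = 1 := by
      rcases Nat.lt_or_ge (a : ℕ) 1 with h | h
      · exact Or.inl (Fin.ext (by rw [Fin.val_zero]; omega))
      · exact Or.inr (Fin.ext (by rw [Fin.val_one]; have := a.2; omega))
    refine (Finite.injective_iff_bijective).1 fun s s' h => Fin.ext ?_
    have h' : (((φ ∘ ιw) (e.symm (a, s)) : Fin N) : ℕ) = (((φ ∘ ιw) (e.symm (a, s')) : Fin N) : ℕ) :=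
      congrArg Fin.val h
    rcases ha with rfl | rfl
    · rw [hblkw0, hblkw0] at h'
      exact h'
    · rw [hblkw1, hblkw1] at h'
      exact fourOddWitness_block1_inj h'
  have hxw0 : wordBlockSign ℂ e (φ ∘ ιw) ≠ 0 := by
    unfold wordBlockSign
    rw [if_pos hbijw]
    exact Finset.prod_ne_zero_iff.2 fun a _ => Int.cast_ne_zero.2 (Units.ne_zero _)
  -- the third leg is supported: column reading `(2,3,1,0)`, dominoes `(1,0)…(0,1)…`, zero arm
  have hwwv : ∀ q : Fin (N * 2), (((γ ∘ ιw) q : Fin N) : ℕ) =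
      (if (q : ℕ) = 0 then 2 else if (q : ℕ) = 1 then 3 else if (q : ℕ) = 2 then 1 else if (q : ℕ) = 3 then 0 else if (q : ℕ) < 2 * j + 4 then ((q : ℕ) + 1) % 2 else if (q : ℕ) < 4 * j + 4 then (q : ℕ) % 2 else 0) := by
    intro q
    show ((γ (ιw q) : Fin N) : ℕ) = _
    rw [hγv]
    exact fourOddWitness_third hN q.2 (hιw q)
  have harmw : ∀ q : Fin (N * 2), 4 * j + 4 ≤ (q : ℕ) → (((γ ∘ ιw) q : Fin N) : ℕ) = 0 := by
    intro q hq; rw [hwwv]; split_ifs <;> omega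
  have hltw : ∀ q : Fin (N * 2), (q : ℕ) < 4 → (((γ ∘ ιw) q : Fin N) : ℕ) < 4 := by
    intro q hq; rw [hwwv]; split_ifs <;> omega
  have hinjw : ∀ q q' : Fin (N * 2), (q : ℕ) < 4 → (q' : ℕ) < 4 → (γ ∘ ιw) q = (γ ∘ ιw) q' → q = q' := by
    intro q q' hq hq' h
    have h' := congrArg Fin.val h
    rw [hwwv, hwwv] at h'
    exact Fin.ext (fourOddWitness_third_inj hq hq' h')
  have hdsw : ∀ p q : Fin (N * 2), 4 ≤ (p : ℕ) → (q : ℕ) < 4 * j + 4 → (q : ℕ) = (p : ℕ) + 1 → (p : ℕ) % 2 = 0 →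
      (((γ ∘ ιw) p : Fin N) : ℕ) + (((γ ∘ ιw) q : Fin N) : ℕ) = 1 := by
    intro p q hp hq hqp hpe
    rw [hwwv, hwwv]
    exact fourOddWitness_dominoes hp hq hqp hpe
  have hpm : ∀ (c : Prop) [Decidable c], (if c then (1 : ℂ) else -1) ≠ 0 := by
    intro c _; split_ifs <;> norm_num
  rw [hχw, ← mul_assoc, wordBlockSign_mul_self_of_ne_zero e hxw0, one_mul,
    fourOddTableau_apply_eq_parity hNY T hT hj4 harmw hltw hinjw hdsw]
  exact hpm _

end Summit.MatrixMultiplication.MatrixMultiplication.Theorems.ObstructionCalculus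

end
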